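import Literature.RingTheory.MvPolynomial.HomogeneousHilbertFunction
import Mathlib.RingTheory.MvPolynomial.WeightedHomogeneous
import Mathlib.RingTheory.MvPolynomial.Basic
import HarnessLib

/-!
# The Hilbert function of a multihomogeneous ideal: lattice identities and the
# non-zero-divisor formula, for a weight grading

Topic: `Literature/RingTheory/MvPolynomial`. The weighted (multi)graded companion of
`HomogeneousHilbertFunction.lean`: `S = K[X_σ]` is graded by a weight `w : σ → M` into an
additive commutative monoid (Mathlib `MvPolynomial.IsWeightedHomogeneous`,
`weightedHomogeneousSubmodule`, `weightedHomogeneousComponent`), the case of interest being a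
block multigrading `M = ℕ^ι`, `w i = e_{blk i}`. For an ideal `I` closed under taking weighted
components (a `w`-homogeneous ideal, in the explicit form
`∀ p ∈ I, ∀ m, weightedHomogeneousComponent w m p ∈ I`, so that no graded-ring instance is
needed) the pieces are the `K`-subspaces `I_t = I ∩ S_t`
(`Submodule.restrictScalars K I ⊓ weightedHomogeneousSubmodule K w t`) and the Hilbert function
is `H(I; t) = dim_K S_t - dim_K I_t`. We prove, exactly as in the single-graded file:

* `wpiece_inf`, `wpiece_sup`, **`finrank_wpiece_inf_add_sup`** —
  `dim (I ∩ J)_t + dim (I + J)_t = dim I_t + dim J_t`;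
* `weightedHomogeneousComponent_mul_add` — `(Q r)_{t+q} = Q · r_t` for `Q` of weight `q` in a
  cancellative grading;
* `wpiece_sup_span_singleton` — `(I + (Q))_{t+q} = I_{t+q} + Q · S_t`, whence the general
  inequality **`finrank_wpiece_sup_span_add_le`** and, for `Q` a non-zero-divisor modulo `I`,
  the equality **`finrank_wpiece_sup_span_add_eq`**:
  `dim (I + (Q))_{t+q} + dim I_t = dim I_{t+q} + dim S_t`, i.e.
  `H(I + (Q); t + q) = H(I; t + q) - H(I; t)` (van der Waerden 1928, §2; Philippon 1986,
  Lemme 3.1 in the multigraded reading);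
* the pieces are finite-dimensional for a positive multigrading `w : σ → ℕ^ι` (`w i ≠ 0`),
  `finite_weightedHomogeneousSubmodule_of_ne_zero`, and Hilbert-function forms of the identities.

## References

* B. L. van der Waerden, *On Hilbert's function, series of composition of ideals and a
  generalization of the theorem of Bézout*, Proc. Royal Acad. Amsterdam 31 (1928), 749–770, §2.
* P. Philippon, *Lemmes de zéros dans les groupes algébriques commutatifs*, Bull. Soc. Math.
  France 114 (1986), Lemme 3.1. [Philippon1986]
-/

noncomputable section

open MvPolynomial Module

namespace Literature.RingTheory.MvPolynomial

variable {K : Type*} [Field K] {σ : Type*} {M : Type*} [AddCommMonoid M]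

/-! ## The pieces `I_t = I ∩ S_t` -/

/-- Membership in the piece `I_t`. [folklore] -/
theorem mem_wpiece {w : σ → M} {I : Ideal (MvPolynomial σ K)} {t : M} {f : MvPolynomial σ K} :
    f ∈ Submodule.restrictScalars K I ⊓ weightedHomogeneousSubmodule K w t ↔
      f ∈ I ∧ f.IsWeightedHomogeneous w t := by
  rw [Submodule.mem_inf, Submodule.restrictScalars_mem, mem_weightedHomogeneousSubmodule]

/-- `I ↦ I_t` is monotone. [folklore] -/
theorem wpiece_mono (w : σ → M) {I J : Ideal (MvPolynomial σ K)} (h : I ≤ J) (t : M) :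
    Submodule.restrictScalars K I ⊓ weightedHomogeneousSubmodule K w t ≤
      Submodule.restrictScalars K J ⊓ weightedHomogeneousSubmodule K w t :=
  fun _ hf => ⟨h hf.1, hf.2⟩

/-- `dim I_t ≤ dim J_t` for `I ≤ J`. [folklore] -/
theorem finrank_wpiece_mono (w : σ → M) {I J : Ideal (MvPolynomial σ K)} (h : I ≤ J) (t : M)
    [Module.Finite K (weightedHomogeneousSubmodule K w t)] :
    finrank K ↥(Submodule.restrictScalars K I ⊓ weightedHomogeneousSubmodule K w t) ≤
      finrank K ↥(Submodule.restrictScalars K J ⊓ weightedHomogeneousSubmodule K w t) :=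
  Submodule.finrank_mono (wpiece_mono w h t)

/-- `dim I_t ≤ dim S_t`. [folklore] -/
theorem finrank_wpiece_le (w : σ → M) (I : Ideal (MvPolynomial σ K)) (t : M)
    [Module.Finite K (weightedHomogeneousSubmodule K w t)] :
    finrank K ↥(Submodule.restrictScalars K I ⊓ weightedHomogeneousSubmodule K w t) ≤
      finrank K (weightedHomogeneousSubmodule K w t) :=
  Submodule.finrank_mono inf_le_right

/-- `(0)_t = 0`. [folklore] -/
theorem wpiece_bot (w : σ → M) (t : M) :
    Submodule.restrictScalars K (⊥ : Ideal (MvPolynomial σ K)) ⊓ weightedHomogeneousSubmodule K w t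
      = ⊥ := by
  ext f
  rw [mem_wpiece, Ideal.mem_bot, Submodule.mem_bot]
  constructor
  · exact fun h => h.1
  · rintro rfl
    exact ⟨rfl, isWeightedHomogeneous_zero K w t⟩

/-- `(1)_t = S_t`. [folklore] -/
theorem wpiece_top (w : σ → M) (t : M) :
    Submodule.restrictScalars K (⊤ : Ideal (MvPolynomial σ K)) ⊓ weightedHomogeneousSubmodule K w t
      = weightedHomogeneousSubmodule K w t := by
  ext f
  rw [mem_wpiece, mem_weightedHomogeneousSubmodule]
  simp

/-! ## Lattice identities -/

/-- `(I ∩ J)_t = I_t ∩ J_t`. [folklore] -/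
theorem wpiece_inf (w : σ → M) (I J : Ideal (MvPolynomial σ K)) (t : M) :
    Submodule.restrictScalars K (I ⊓ J) ⊓ weightedHomogeneousSubmodule K w t =
      (Submodule.restrictScalars K I ⊓ weightedHomogeneousSubmodule K w t) ⊓
        (Submodule.restrictScalars K J ⊓ weightedHomogeneousSubmodule K w t) := by
  ext f
  simp only [Submodule.mem_inf, Submodule.restrictScalars_mem]
  tauto

/-- `(I + J)_t = I_t + J_t` for `w`-HOMOGENEOUS `I`, `J` (take weight-`t` components of a
decomposition `f = i + j`). [folklore] -/
theorem wpiece_sup [DecidableEq M] (w : σ → M) {I J : Ideal (MvPolynomial σ K)}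
    (hI : ∀ p ∈ I, ∀ m, weightedHomogeneousComponent w m p ∈ I)
    (hJ : ∀ p ∈ J, ∀ m, weightedHomogeneousComponent w m p ∈ J) (t : M) :
    Submodule.restrictScalars K (I ⊔ J) ⊓ weightedHomogeneousSubmodule K w t =
      (Submodule.restrictScalars K I ⊓ weightedHomogeneousSubmodule K w t) ⊔
        (Submodule.restrictScalars K J ⊓ weightedHomogeneousSubmodule K w t) := by
  apply le_antisymm
  · intro f hf
    obtain ⟨hfIJ, hft⟩ := mem_wpiece.mp hf
    obtain ⟨i, hi, j, hj, rfl⟩ := Submodule.mem_sup.mp hfIJ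
    rw [← weightedHomogeneousComponent_eq_self hft, map_add]
    exact Submodule.add_mem_sup
      (mem_wpiece.mpr ⟨hI i hi t, weightedHomogeneousComponent_isWeightedHomogeneous t i⟩)
      (mem_wpiece.mpr ⟨hJ j hj t, weightedHomogeneousComponent_isWeightedHomogeneous t j⟩)
  · exact sup_le (wpiece_mono w le_sup_left t) (wpiece_mono w le_sup_right t)

/-- **`dim (I ∩ J)_t + dim (I + J)_t = dim I_t + dim J_t`** for `w`-homogeneous `I`, `J`
(`H(I ∩ J; t) + H(I + J; t) = H(I; t) + H(J; t)`). [folklore] -/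
theorem finrank_wpiece_inf_add_sup [DecidableEq M] (w : σ → M) {I J : Ideal (MvPolynomial σ K)}
    (hI : ∀ p ∈ I, ∀ m, weightedHomogeneousComponent w m p ∈ I)
    (hJ : ∀ p ∈ J, ∀ m, weightedHomogeneousComponent w m p ∈ J) (t : M)
    [Module.Finite K (weightedHomogeneousSubmodule K w t)] :
    finrank K ↥(Submodule.restrictScalars K (I ⊓ J) ⊓ weightedHomogeneousSubmodule K w t) +
      finrank K ↥(Submodule.restrictScalars K (I ⊔ J) ⊓ weightedHomogeneousSubmodule K w t) =
      finrank K ↥(Submodule.restrictScalars K I ⊓ weightedHomogeneousSubmodule K w t) +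
        finrank K ↥(Submodule.restrictScalars K J ⊓ weightedHomogeneousSubmodule K w t) := by
  rw [wpiece_inf, wpiece_sup w hI hJ, add_comm, Submodule.finrank_sup_add_finrank_inf_eq]

/-! ## Multiplication by a form of weight `q` -/

/-- **`(Q · r)_{t+q} = Q · r_t`** for `Q` weighted homogeneous of weight `q`, in a cancellative
grading. [folklore] -/
theorem weightedHomogeneousComponent_mul_add [IsCancelAdd M] {w : σ → M} {Q : MvPolynomial σ K}
    {q : M} (hQ : Q.IsWeightedHomogeneous w q) (r : MvPolynomial σ K) (t : M) :
    weightedHomogeneousComponent w (t + q) (Q * r) = Q * weightedHomogeneousComponent w t r := by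
  classical
  ext x
  rw [coeff_weightedHomogeneousComponent, coeff_mul, coeff_mul]
  have key : ∀ p ∈ Finset.antidiagonal x,
      coeff p.1 Q * coeff p.2 (weightedHomogeneousComponent w t r) =
        if Finsupp.weight w x = t + q then coeff p.1 Q * coeff p.2 r else 0 := by
    rintro ⟨u, v⟩ huv
    rw [Finset.mem_antidiagonal] at huv
    dsimp only
    rw [coeff_weightedHomogeneousComponent]
    by_cases hu : coeff u Q = 0
    · simp [hu]
    · have hwu : Finsupp.weight w u = q := hQ hu
      have hx : Finsupp.weight w x = Finsupp.weight w v + q := by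
        rw [← huv, map_add, hwu, add_comm]
      by_cases hv : Finsupp.weight w v = t
      · rw [if_pos hv, if_pos (by rw [hx, hv])]
      · rw [if_neg hv, mul_zero, if_neg]
        rw [hx]
        exact fun h => hv (add_right_cancel h)
  rw [Finset.sum_congr rfl key]
  split_ifs with h
  · rfl
  · rw [Finset.sum_const_zero]

/-- **`(I + (Q))_{t+q} = I_{t+q} + Q · S_t`** for a `w`-homogeneous ideal `I` and `Q` of weight
`q` (cancellative grading). [folklore] -/
theorem wpiece_sup_span_singleton [DecidableEq M] [IsCancelAdd M] (w : σ → M)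
    {I : Ideal (MvPolynomial σ K)} (hI : ∀ p ∈ I, ∀ m, weightedHomogeneousComponent w m p ∈ I)
    {Q : MvPolynomial σ K} {q : M} (hQ : Q.IsWeightedHomogeneous w q) (t : M) :
    Submodule.restrictScalars K (I ⊔ Ideal.span {Q}) ⊓ weightedHomogeneousSubmodule K w (t + q) =
      (Submodule.restrictScalars K I ⊓ weightedHomogeneousSubmodule K w (t + q)) ⊔
        (weightedHomogeneousSubmodule K w t).map (LinearMap.mulLeft K Q) := by
  apply le_antisymm
  · intro f hf
    obtain ⟨hf', hft⟩ := mem_wpiece.mp hf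
    obtain ⟨i, hi, j, hj, rfl⟩ := Submodule.mem_sup.mp hf'
    obtain ⟨r, rfl⟩ := Ideal.mem_span_singleton'.mp hj
    rw [← weightedHomogeneousComponent_eq_self hft, map_add, mul_comm r Q,
      weightedHomogeneousComponent_mul_add hQ r t]
    refine Submodule.add_mem_sup (mem_wpiece.mpr
      ⟨hI i hi _, weightedHomogeneousComponent_isWeightedHomogeneous _ i⟩) ?_
    exact ⟨weightedHomogeneousComponent w t r, weightedHomogeneousComponent_mem w r t, rfl⟩
  · refine sup_le (wpiece_mono w le_sup_left _) ?_
    rintro _ ⟨r, hr, rfl⟩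
    refine mem_wpiece.mpr ⟨Ideal.mem_sup_right (Ideal.mem_span_singleton'.mpr ⟨r, mul_comm r Q⟩),
      ?_⟩
    rw [SetLike.mem_coe, mem_weightedHomogeneousSubmodule] at hr
    simpa [add_comm] using hQ.mul hr

/-- `Q · I_t ⊆ I_{t+q} ∩ Q · S_t`. [folklore] -/
theorem map_mulLeft_wpiece_le (w : σ → M) {I : Ideal (MvPolynomial σ K)} {Q : MvPolynomial σ K}
    {q : M} (hQ : Q.IsWeightedHomogeneous w q) (t : M) :
    (Submodule.restrictScalars K I ⊓ weightedHomogeneousSubmodule K w t).map (LinearMap.mulLeft K Q)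
      ≤ (Submodule.restrictScalars K I ⊓ weightedHomogeneousSubmodule K w (t + q)) ⊓
        (weightedHomogeneousSubmodule K w t).map (LinearMap.mulLeft K Q) := by
  rintro _ ⟨r, hr, rfl⟩
  obtain ⟨hrI, hrt⟩ := mem_wpiece.mp hr
  refine ⟨mem_wpiece.mpr ⟨I.mul_mem_left Q hrI, ?_⟩, r, ?_, rfl⟩
  · simpa [add_comm] using hQ.mul hrt
  · rw [SetLike.mem_coe, mem_weightedHomogeneousSubmodule]; exact hrt

/-- With `Q` a non-zero-divisor modulo `I`: `I_{t+q} ∩ Q · S_t = Q · I_t`. [folklore] -/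
theorem wpiece_inf_map_mulLeft_eq (w : σ → M) {I : Ideal (MvPolynomial σ K)}
    {Q : MvPolynomial σ K} {q : M} (hQ : Q.IsWeightedHomogeneous w q)
    (hnzd : ∀ f, Q * f ∈ I → f ∈ I) (t : M) :
    (Submodule.restrictScalars K I ⊓ weightedHomogeneousSubmodule K w (t + q)) ⊓
        (weightedHomogeneousSubmodule K w t).map (LinearMap.mulLeft K Q) =
      (Submodule.restrictScalars K I ⊓ weightedHomogeneousSubmodule K w t).map
        (LinearMap.mulLeft K Q) := by
  refine le_antisymm ?_ (map_mulLeft_wpiece_le w hQ t)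
  rintro _ ⟨hfI, r, hrt, rfl⟩
  have hrt' : r.IsWeightedHomogeneous w t := by
    rw [SetLike.mem_coe, mem_weightedHomogeneousSubmodule] at hrt; exact hrt
  exact ⟨r, mem_wpiece.mpr ⟨hnzd r (mem_wpiece.mp hfI).1, hrt'⟩, rfl⟩

/-- **Hypersurface section, general inequality**: for a `w`-homogeneous ideal `I` and a
non-zero `Q` of weight `q`, `dim (I + (Q))_{t+q} + dim I_t ≤ dim I_{t+q} + dim S_t`
(`H(I + (Q); t + q) ≥ H(I; t + q) - H(I; t)`). [folklore] -/
theorem finrank_wpiece_sup_span_add_le [DecidableEq M] [IsCancelAdd M] (w : σ → M)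
    {I : Ideal (MvPolynomial σ K)} (hI : ∀ p ∈ I, ∀ m, weightedHomogeneousComponent w m p ∈ I)
    {Q : MvPolynomial σ K} (hQ0 : Q ≠ 0) {q : M} (hQ : Q.IsWeightedHomogeneous w q) (t : M)
    [Module.Finite K (weightedHomogeneousSubmodule K w t)]
    [Module.Finite K (weightedHomogeneousSubmodule K w (t + q))] :
    finrank K ↥(Submodule.restrictScalars K (I ⊔ Ideal.span {Q}) ⊓
        weightedHomogeneousSubmodule K w (t + q)) +
      finrank K ↥(Submodule.restrictScalars K I ⊓ weightedHomogeneousSubmodule K w t) ≤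
      finrank K ↥(Submodule.restrictScalars K I ⊓ weightedHomogeneousSubmodule K w (t + q)) +
        finrank K (weightedHomogeneousSubmodule K w t) := by
  have h1 := Submodule.finrank_sup_add_finrank_inf_eq
    (Submodule.restrictScalars K I ⊓ weightedHomogeneousSubmodule K w (t + q))
    ((weightedHomogeneousSubmodule K w t).map (LinearMap.mulLeft K Q))
  rw [← wpiece_sup_span_singleton w hI hQ t, finrank_map_mulLeft hQ0] at h1
  have h2 : finrank K ↥(Submodule.restrictScalars K I ⊓ weightedHomogeneousSubmodule K w t) ≤
      finrank K ↥((Submodule.restrictScalars K I ⊓ weightedHomogeneousSubmodule K w (t + q)) ⊓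
        (weightedHomogeneousSubmodule K w t).map (LinearMap.mulLeft K Q)) := by
    rw [← finrank_map_mulLeft hQ0 (Submodule.restrictScalars K I ⊓ weightedHomogeneousSubmodule K w t)]
    exact Submodule.finrank_mono (map_mulLeft_wpiece_le w hQ t)
  omega

/-- **Hypersurface section by a non-zero-divisor, multigraded** (van der Waerden 1928 §2;
Philippon 1986, Lemme 3.1): for a `w`-homogeneous ideal `I` and `Q` of weight `q` which is a
non-zero-divisor modulo `I`, `dim (I + (Q))_{t+q} + dim I_t = dim I_{t+q} + dim S_t`, i.e.
`H(I + (Q); t + q) = H(I; t + q) - H(I; t)`. [cite: Philippon1986, Lemme 3.1] -/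
theorem finrank_wpiece_sup_span_add_eq [DecidableEq M] [IsCancelAdd M] (w : σ → M)
    {I : Ideal (MvPolynomial σ K)} (hI : ∀ p ∈ I, ∀ m, weightedHomogeneousComponent w m p ∈ I)
    {Q : MvPolynomial σ K} (hQ0 : Q ≠ 0) {q : M} (hQ : Q.IsWeightedHomogeneous w q)
    (hnzd : ∀ f, Q * f ∈ I → f ∈ I) (t : M)
    [Module.Finite K (weightedHomogeneousSubmodule K w t)]
    [Module.Finite K (weightedHomogeneousSubmodule K w (t + q))] :
    finrank K ↥(Submodule.restrictScalars K (I ⊔ Ideal.span {Q}) ⊓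
        weightedHomogeneousSubmodule K w (t + q)) +
      finrank K ↥(Submodule.restrictScalars K I ⊓ weightedHomogeneousSubmodule K w t) =
      finrank K ↥(Submodule.restrictScalars K I ⊓ weightedHomogeneousSubmodule K w (t + q)) +
        finrank K (weightedHomogeneousSubmodule K w t) := by
  have h1 := Submodule.finrank_sup_add_finrank_inf_eq
    (Submodule.restrictScalars K I ⊓ weightedHomogeneousSubmodule K w (t + q))
    ((weightedHomogeneousSubmodule K w t).map (LinearMap.mulLeft K Q))
  rw [← wpiece_sup_span_singleton w hI hQ t, finrank_map_mulLeft hQ0,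
    wpiece_inf_map_mulLeft_eq w hQ hnzd, finrank_map_mulLeft hQ0] at h1
  omega

/-! ## Homogeneity in the explicit form -/

/-- **An ideal generated by weighted homogeneous elements is closed under weighted components**
(Mathlib's `Ideal.homogeneous_span` for the graded structure `MvPolynomial.weightedGradedAlgebra`,
made explicit). [folklore] -/
theorem weightedHomogeneousComponent_mem_of_mem_span [DecidableEq M] (w : σ → M)
    {G : Set (MvPolynomial σ K)} (hG : ∀ g ∈ G, ∃ k, g.IsWeightedHomogeneous w k)
    {p : MvPolynomial σ K} (hp : p ∈ Ideal.span G) (m : M) :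
    weightedHomogeneousComponent w m p ∈ Ideal.span G := by
  letI : GradedAlgebra (weightedHomogeneousSubmodule K w) := MvPolynomial.weightedGradedAlgebra K w
  have hhom : (Ideal.span G).IsHomogeneous (weightedHomogeneousSubmodule K w) :=
    Ideal.homogeneous_span _ _ fun g hg => by
      obtain ⟨k, hk⟩ := hG g hg
      exact ⟨k, (mem_weightedHomogeneousSubmodule K w k g).mpr hk⟩
  exact MvPolynomial.weightedHomogeneousComponent_mem_of_mem K w hhom hp m

/-- Sums of component-closed ideals are component-closed. [folklore] -/
theorem weightedHomogeneousComponent_mem_sup [DecidableEq M] (w : σ → M)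
    {I J : Ideal (MvPolynomial σ K)} (hI : ∀ p ∈ I, ∀ m, weightedHomogeneousComponent w m p ∈ I)
    (hJ : ∀ p ∈ J, ∀ m, weightedHomogeneousComponent w m p ∈ J) :
    ∀ p ∈ I ⊔ J, ∀ m, weightedHomogeneousComponent w m p ∈ I ⊔ J := by
  intro p hp m
  obtain ⟨i, hi, j, hj, rfl⟩ := Submodule.mem_sup.mp hp
  rw [map_add]
  exact Submodule.add_mem_sup (hI i hi m) (hJ j hj m)

/-- Intersections of component-closed ideals are component-closed. [folklore] -/
theorem weightedHomogeneousComponent_mem_inf (w : σ → M)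
    {I J : Ideal (MvPolynomial σ K)} (hI : ∀ p ∈ I, ∀ m, weightedHomogeneousComponent w m p ∈ I)
    (hJ : ∀ p ∈ J, ∀ m, weightedHomogeneousComponent w m p ∈ J) :
    ∀ p ∈ I ⊓ J, ∀ m, weightedHomogeneousComponent w m p ∈ I ⊓ J :=
  fun p hp m => ⟨hI p hp.1 m, hJ p hp.2 m⟩

/-- The principal ideal of a weighted homogeneous element is component-closed. [folklore] -/
theorem weightedHomogeneousComponent_mem_span_singleton [DecidableEq M] (w : σ → M)
    {Q : MvPolynomial σ K} {q : M} (hQ : Q.IsWeightedHomogeneous w q) :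
    ∀ p ∈ Ideal.span {Q}, ∀ m, weightedHomogeneousComponent w m p ∈ Ideal.span {Q} :=
  fun _ hp m => weightedHomogeneousComponent_mem_of_mem_span w
    (fun g hg => ⟨q, by rw [Set.mem_singleton_iff.mp hg]; exact hQ⟩) hp m

/-- **The colon ideal `(I : Q^k)` of a component-closed ideal by a power of a weighted homogeneous
element is component-closed** (cancellative grading). [folklore] -/
theorem weightedHomogeneousComponent_mem_colon_pow [IsCancelAdd M] (w : σ → M)
    {I : Ideal (MvPolynomial σ K)} (hI : ∀ p ∈ I, ∀ m, weightedHomogeneousComponent w m p ∈ I)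
    {Q : MvPolynomial σ K} {q : M} (hQ : Q.IsWeightedHomogeneous w q) (k : ℕ)
    {p : MvPolynomial σ K} (hp : Q ^ k * p ∈ I) (m : M) :
    Q ^ k * weightedHomogeneousComponent w m p ∈ I := by
  have hQk : (Q ^ k).IsWeightedHomogeneous w (k • q) := hQ.pow k
  rw [← weightedHomogeneousComponent_mul_add hQk p m]
  exact hI _ hp _

/-! ## Finiteness of the pieces of a positive multigrading -/

/-- For a positive multigrading `w : σ → ℕ^ι` (`w i ≠ 0` for all `i`) and finitely many
variables, a polynomial of weight `t` has total degree `≤ Σ_l t_l`, so **`S_t` is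
finite-dimensional**. [folklore] -/
theorem finite_weightedHomogeneousSubmodule_of_ne_zero [Finite σ] {ι : Type*} [Fintype ι]
    (w : σ → ι → ℕ) (hw : ∀ i, w i ≠ 0) (t : ι → ℕ) :
    Module.Finite K (weightedHomogeneousSubmodule K w t) := by
  classical
  have hle : weightedHomogeneousSubmodule K w t ≤ restrictTotalDegree σ K (∑ l, t l) := by
    intro p hp
    rw [mem_weightedHomogeneousSubmodule] at hp
    rw [mem_restrictTotalDegree, totalDegree, Finset.sup_le_iff]
    intro d hd
    have hwd : Finsupp.weight w d = t := hp (mem_support_iff.mp hd)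
    -- `|d| ≤ Σ_l (weight w d)_l`
    have h1 : (d.sum fun _ e => e) ≤ ∑ l, Finsupp.weight w d l := by
      have hexp : ∀ l, Finsupp.weight w d l = ∑ i ∈ d.support, d i * w i l := fun l => by
        rw [Finsupp.weight_apply, Finsupp.sum, Finset.sum_apply l d.support (fun i => d i • w i)]
        exact Finset.sum_congr rfl fun i _ => by simp
      simp_rw [hexp]
      rw [Finset.sum_comm, Finsupp.sum]
      refine Finset.sum_le_sum fun i _ => ?_
      obtain ⟨l, hl⟩ : ∃ l, w i l ≠ 0 := by
        by_contra h
        push Not at h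
        exact hw i (funext h)
      calc d i = d i * 1 := (mul_one _).symm
        _ ≤ d i * w i l := Nat.mul_le_mul_left _ (Nat.one_le_iff_ne_zero.mpr hl)
        _ ≤ ∑ l', d i * w i l' :=
            Finset.single_le_sum (f := fun l' => d i * w i l') (fun _ _ => Nat.zero_le _)
              (Finset.mem_univ l)
    rw [hwd] at h1
    exact h1
  exact Submodule.finiteDimensional_of_le hle

end Literature.RingTheory.MvPolynomial

end
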